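import Summits.ResolutionOfSingularities.ResolutionOfSingularities.Theorems.PerronCharts
import Summits.ResolutionOfSingularities.ResolutionOfSingularities.Theorems.ToricLadder
import Literature.AlgebraicGeometry.Resolution.MonomializationAlongValuation
import Literature.AlgebraicGeometry.Resolution.ExcellentRingsFieldProofs
import Literature.RingTheory.KrullDimension.LocalizationDimension
import Summits.ResolutionOfSingularities.ResolutionOfSingularities.Theorems.RadicialJungCleanModelsStubCjs2020Cor15
import HarnessLib

/-!
# PerronMonomialization — decomp-res node «PerronLadder» (lens-1 g17 KaplanskyLadder → g18 PerronLadder), tree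
file 6/11 of the node

Content VERBATIM from the decomp-res lens-1 g18 file `HOME/decomp-res-lens-1/g18/PerronLadder.lean` (sha256
8bb02ceefe11b749, 3725 l; it SUPERSEDES
g17 `KaplanskyLadder.lean` fb35e2e5 ⊇ g16 `ToricLadder.lean` 67376591 as landing source; PARTS I–III = the
landed `Theorems/ToricLadderCells`,
`ToricLadderKernels`, `ToricLadderLinks`, `ToricLadderDense`, `ToricLadder` — not repeated).  HOME =
run/shared/lean/pub/decomp-res.  Critic:
CRITIC-LEDGER rows 131 (g17, 2026-08-30T18:47:14Z) and 138 (g18 CLEARED, landing order 2026-08-30T20:05:14Z); the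
lens's WRITER.md (endorsed).
Landed by decomp-res writer g7 as SUPPORT of the Valuative route item 0641 `LuAlphaPTorsor` (helper files; no
Valuative route edit is made by the
decomp-res cell: the support ports Σ₁ `MonoidalStep` / Π₁ `KK05NCVAscent`, the retirement of g16's all-rank
`ToricAscent 3` in favour of the theorem
`toricAscentRk1_three`, and the UNCHANGED located residual `NonKHToricArchLU 3 3 4` / port-free `NonKHArchLU 3 4`
stay documented tree definitions
for the Valuative tenure / operator to book).

PART V-D (g18 NEW) §20 KERNEL modulo the NAMED FACT: local monomialization of one element along the valuation (CJS 2020) —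
`exists_localRing_monomial_of_embeddedResolution_le` (the tree's
`MonomializationAlongValuation.exists_localRing_monomial_of_embeddedResolution` relaxed to
base dimension `≤ 3`; proof verbatim but for the dimension bound).  PROVED modulo `CossartJannsenSaito2020Embedded`, 0 sorry.

[WRITER NOTE (decomp-res writer g7): namespaces `…Theses.PerronLadder` ↦ `…Theorems.KaplanskyLadder` (PART IV
= g17 §14–§16, files
`KaplanskyLadder`, `KaplanskyLadderDefectless`) and ↦ `…Theorems.PerronLadder` (PART V, files `PerronMerge`
§17, `PerronCharts` §18–§19,
`PerronMonomialization` §20, `PerronInitialChartPrelim` + `PerronInitialChart` §21 (400-line limit),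
`PerronRepresentations` §22, `PerronAscent`
§23, `PerronLadder` §24; PART IV likewise `KaplanskyHensel` §14 / `KaplanskyLadder` §15), with `open
…Theorems.ToricLadder` (+ `…KaplanskyLadder`) so the lens's unqualified references stay verbatim; `section PartV` and its
section-scoped `open`s re-opened per file; the g16 helper `intermediateField_top_fg` is the landed
`PfaffLine.intermediateField_top_fg_of_isFractionRing`
(renamed at its use, as in the landed `ToricLadder`); global `set_option` lines dropped; nothing else changed.]

## The lens's node description (VERBATIM)

# PerronLadder — decomposition NODE (decomp-res lens-1 «grading / quantitative ladder», gen 18)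

HOST (verbatim): `Summit.ResolutionOfSingularities.ResolutionOfSingularities.Theses.Valuative.LuAlphaPTorsor`
(stmt-ResolutionOfSingularities-0641, route `Valuative`, deciding theorem
`Valuative.closes (h₂ : LuAlphaPTorsor) (h₄ : TorsorToLurel) (h₃ : PatchingRel) : ResolutionOfSingularities`).
ROOT: `_root_.ResolutionOfSingularities`.

TARGET of this generation (critic window g18, option (ii)): the PORT-SHAPED TARGET `ToricAscent 3` of
gen 16/17 — toric ascent over THREEFOLD bases, the hypothesis under which the located residual
`NonToricArchLU 2 4` shrinks EXACTLY to the true residual `NonToricArchLU 3 4` (g16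
`nonToricArchLU_two_four_iff_three`) — DECIDED, in the RANK-ONE form `ToricAscentRk1 3` that the located
residuals actually consume (they quantify over rank-one valuations only), MODULO
* the NAMED FACT `Literature.AlgebraicGeometry.Resolution.CossartJannsenSaito2020Embedded` (tree;
  Cossart–Jannsen–Saito 2020 Thm. 1.4 / Cor. 1.5: embedded resolution of reduced closed subschemes of
  dimension `≤ 2` of excellent regular schemes), consumed through the tree theorem
  `RadicialJung.CleanModels.stub_cjs2020Cor15_of_embedded` exactly as the tree's
  `exists_localRing_monomial_of_embeddedResolution` consumes it;
* PORT Σ₁ `MonoidalStep` — ONE monoidal transform of a regular local chart along the valuation with a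
  regular two-parameter centre is again a regular local chart with the transformed parameter family
  (Zariski 1940 §B; Knaf–Kuhlmann 2005 §4 p. 9 L36–L55; Cutkosky arXiv:1404.7459 §2.1 p. 4 L13–L15);
* PORT Π₁ `KK05NCVAscent` — Knaf–Kuhlmann 2005 (arXiv:math/0304159) Theorem 4.1 with `τ = 0`, typed as
  printed UNDER ITS OWN HYPOTHESES (NC) and (V) (p. 9 L59–L112, proof pp. 10–11): over a regular local
  chart whose parameter family has rationally independent values, finitely many elements of `F₁(x)` whose
  representing polynomials have MONOMIAL coefficients lie in a regular essentially finitely generated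
  model of `F₁(x)` dominated by `O`.
The (NC)/(V) PREPARATION that KK05 §4 (1)–(3) delegates to print (embedded resolution in the base +
"Perron transforms") is done HERE: (NC) by the CJS named fact in dimension `≤ 3` (KERNEL modulo the fact,
PART V-D/E), (V) by PERRON–ZARISKI MERGING in KERNEL (Lemma M, PART V-A/C) driving the monoidal step Σ₁.

PARTS I–IV (§§1–16) are the gen-17 node `KaplanskyLadder` VERBATIM (file
`run/shared/lean/pub/decomp-res/decomp-res-lens-1/g17/KaplanskyLadder.lean`, sha256
`fb35e2e5f969e6302880c7fc979de14df8f5a991dae1f82cfac5832f97cd5030` → see `g18/parts/SHA256SUMS`,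
re-namespaced `…Theses.PerronLadder`; ONE docstring citation block added (hygiene h4: Kaplansky 1942
 theorem numbers inside `KHTopBelow`); not in the tree, carried to keep the node self-contained and compiling).

PART V (§§17–24, NEW in gen 18) — THE PERRON LADDER:
* §17 V-A · KERNEL · LEMMA M `mergeReachable_of_le_three`: for `m ≤ 3` non-negative real values, finitely
  many LEGAL SUBTRACTIVE MOVES `τ i ↦ τ i - τ s` (`i ≠ s`, `0 < τ s ≤ τ i`) reach a vector whose non-zero
  entries are `ℤ`-independent (Φ-descent on the minimal weight of a relation, with tie-merging; the
  ancestor is Zariski 1940 §B.I Thm. 1, which merges ONE rational dependence by a Perron transformation —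
  corpus `book:editornd-oscar-zariski-collected-papers` pp. 536–537).  `m = 4` is out of reach of the same
  descent (stuck configuration `(5, -2, -2, -2)`), and is not needed: charts of threefold bases have `≤ 3`
  parameters.
* §18 V-B · charts `RegChart O F₁ S` (regular local `k`-subalgebra of `F₁`, dominated by `O`, units = value
  `1`, `F₁ = Frac S`, essentially of finite type), parameter families `IsParamFamily`, monomials
  `IsMonomialIn`, value independence `ValIndepFamily`; PORT Σ₁ `MonoidalStep`.
* §19 V-C · KERNEL · monomials survive a monoidal step (`IsMonomialIn.update`); the logarithmic dictionary
  in rank one (`rv`, `lv`); the (V)-UPGRADE `valIndep_upgrade`: Lemma M + Σ₁ turn any parameter family with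
  `≤ 3` members into a VALUE-INDEPENDENT one on a dominating chart, keeping finitely many monomials monomial.
* §20 V-D · KERNEL modulo the NAMED FACT · `exists_localRing_monomial_of_embeddedResolution_le`: the tree
  theorem `exists_localRing_monomial_of_embeddedResolution` (one element of a regular local ring of
  dimension `3` becomes a MONOMIAL in a regular local ring dominated by the valuation, after adjoining
  finitely many elements of the fraction field) with `ringKrullDim R = 3` relaxed to `= n + 1`, `n ≤ 2`
  (proof verbatim otherwise).
* §21 V-E · KERNEL · `exists_initial_chart`: from a regular affine base `B₀` of `F₁` with `trdeg F₁ ≤ 3`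
  (g15 `regularBase_of_relLU`) and finitely many non-zero `w ∈ B₀`, a regular local chart `S ⊇ B₀` of `F₁`
  of dimension `≤ 3` with a parameter family in which every `w` is MONOMIAL (V-D applied in
  `Spec (B₀)_𝔭` to `∏ w`; excellence of `(B₀)_𝔭` from the tree's `ExcellentRingsField`; dimension from
  `AffineDomainDimension` / `LocalizationDimension`; the field case `dim = 0` separately).
* §22 V-F · KERNEL · representations of the elements of `F₁(x)` as quotients of polynomials in `x` with
  coefficients in `B₀` (`exists_rep_integral`).
* §23 V-G · PORT Π₁ `KK05NCVAscent` and the composition `toricAscent_core`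
  (V-E → V-C upgrade → V-F representations with monomial coefficients → Π₁).
* §24 V-H · the rank-one port-shaped target `ToricAscentRk1 e`; **`toricAscentRk1_three`**
  (DECIDED-MOD-PORT); the rank-one cell `ToricDenseLURk1 e n` and **`toricDenseLURk1_three_perron`**
  (NEW CELL DECIDED at every rung); the cuts **`nonToricArchLU_two_four_iff_three_perron :
  NonToricArchLU 2 4 ↔ NonToricArchLU 3 4`**, **`luRel_four_iff_nonToric_three_perron :
  LURel 4 ↔ NonToricArchLU 3 4`**, **`luRel_four_iff_nonKHToric_three_perron :
  LURel 4 ↔ NonKHToricArchLU 3 3 4`**; ROOT BY NAME **`closes_perron`** (and `closes_perron'` through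
  `Valuative.closes`); WEAKER certificates `toricAscentRk1_of_root`, `toricAscentRk1_of_hostCone`,
  `toricDenseLURk1_of_root`; summaries `root_iff_nonToric_perron`, `root_iff_nonKHToric_perron`.

INHABITANT of the newly decided cell OUTSIDE every previously decided cell (window (ii) requirement —
"an inhabitant in ToricDense₃ ∖ KH₃(4) ∩ hyps"): I2 = `K = F(x₄)`, `F = k(x₁,x₂,x₃)` carrying a rank-one
valuation trivial on `k` with residue field `k` and value group `Γ_F = ℤ[1/p]·1 ⊕ ℤ[1/p]·√2 ⊂ ℝ`
(exists: Kuhlmann 2004 = arXiv:1003.5685 «Value groups, residue fields and bad places of rational function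
fields», Thm. 1.1 (p. 3 L47–L55): the rational function field in `n > ρ + τ` variables over any field
carries a valuation trivial on the constants with ANY prescribed value group of rational rank `ρ` and
countably generated residue field of transcendence degree `τ`; here `n = 3 > 2 + 0`), extended to `K` by
the Gauss–Bourbaki valuation with `v x₄ = √3` (KK05 Thm. 2.1 / Cor. 2.2; tree `KnafKuhlmann2005_Cor22`).
Then: rank one ✓, residue
field `k` (zero-dimensional) ✓, `rr Γ_K = 3 < 4 = trdeg` ⇒ NOT Abhyankar ✓; NOT SepDense(`≤ 3`) (a dense
finitely generated subfield `F₀` of trdeg `3` has `Γ_{F₀} = Γ_K` and `F₀v = k`, so `F₀` would be an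
Abhyankar function field with non-finitely-generated value group ✗) ✓; IN ToricDense₃ with `F₂ = F`,
`x = x₄` (`v x₄ = √3` is free over `Γ_F`, toric field `= K`, trivially separable and dense) ✓; NOT in
ToricDense₂ (over a subfield `F₂'` of trdeg `≤ 2` either `rr Γ_{F₂'} ≤ 1` and `Γ_K / Γ_{F₂'}` contains
`ℤ[1/p]/ℤ`-torsion — never free — or the toric field has trdeg `≤ 3 <` trdeg `K` and density forces an
Abhyankar dense subfield ✗) ✓; NOT in KH₃(4) (a Kaplansky–Hensel top over `F₁'` of trdeg `3` is
IMMEDIATE: `Γ_K = Γ_{F₁'}`, and `F₁'` of trdeg `3 = rr Γ_K` with residue field `k` is Abhyankar, so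
`Γ_{F₁'}` is finitely generated ≠ `Γ_K` ✗) ✓.  (g17's inhabitant J1 — `F₂ = k(m₁,m₂,z)`, `x = m₃` — lies
in KH₃(4) and is NOT claimed here.)  The TRUE residual `NonKHToricArchLU 3 3 4` stays inhabited by
I3 (`Γ_K = ℤ[1/p]·(1 ⊕ √2 ⊕ √3)`, residue `k`: `Γ_K` is `p`-divisible, so NO quotient `Γ_K/Γ_{F₂}` by a
proper finitely generated subfield's group is free of positive rank ⇒ no toric datum for ANY `e`; not KH
as for I2) — UNDECIDED, located.

Kernel-checked net effect: modulo floor + CJS + Σ₁ + Π₁ + patching,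
`ResolutionOfSingularities ↔ (∀ d ≥ 4, NonToricArchLU 3 d) ↔ (∀ d ≥ 4, NonKHToricArchLU 3 3 d)`
(`root_iff_nonToric_perron`, `root_iff_nonKHToric_perron`): the open part of local uniformization for
fourfolds in positive characteristic is EXACTLY the rank-one zero-dimensional non-Abhyankar valuations
whose value group admits NO coordinate-realised free quotient over any finitely generated subfield of
transcendence degree `≤ 3` with separable dense top (no toric–dense presentation at all) and which carry
no Kaplansky–Hensel top over a threefold subfield.

(Sources: CossartPiltant2019; CossartJannsenSaito2020; KnafKuhlmann2005 arXiv:math/0304159 §4 Thm 4.1, Lemmas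
4.2–4.4; KnafKuhlmann2009 arXiv:math/0702856 Prop 3.11, Thm 1.5; Kaplansky1942 Lemma 5, Thm 3; Kuhlmann2010 Thm
2.14; Zariski1940 §B; Cutkosky arXiv:1404.7459 §2.1; ZariskiSamuelII.)
-/

noncomputable section

open IsLocalRing Literature.AlgebraicGeometry.Resolution
open Summit.ResolutionOfSingularities.ResolutionOfSingularities.Theses
open Summit.ResolutionOfSingularities.ResolutionOfSingularities.Theorems
open Summit.ResolutionOfSingularities.ResolutionOfSingularities.Theorems.PfaffLine
open Summit.ResolutionOfSingularities.ResolutionOfSingularities.Theorems.ToricLadder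

namespace Summit.ResolutionOfSingularities.ResolutionOfSingularities.Theorems.PerronLadder

section PartV

open Finset
open CategoryTheory CategoryTheory.Limits AlgebraicGeometry TopologicalSpace
open Scheme.IdealSheafData
open scoped Classical

/-! ## 20. PART V-D · KERNEL modulo the NAMED FACT: local monomialization of one element (CJS 2020) in
dimension `≤ 3` -/

universe u in
/-- **Monomialization of one element along a valuation, local-ring step, dimension `≤ 3`.**  The tree
/-- ``Literature.AlgebraicGeometry.Resolution.exists_localRing_monomial_of_embeddedResolution``: Auxiliary step of
this node's calculus, VERBATIM from the lens file (see the module docstring); the statement is its type. [folklore] -/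
theorem `Literature.AlgebraicGeometry.Resolution.exists_localRing_monomial_of_embeddedResolution`
VERBATIM except that the hypothesis `ringKrullDim R = 3` is relaxed to `ringKrullDim R = n + 1` with
`n ≤ 2` (its proof uses the dimension only to bound `dim V(x) ≤ 2` by
`topologicalKrullDim_zeroLocus_singleton_le`, and `Spec R` is integral Noetherian regular excellent in
any dimension).  [cite: CossartJannsenSaito2020, Cor. 1.5, p. 7] -/
theorem exists_localRing_monomial_of_embeddedResolution_le
    (hEmb : ∀ (Z : Scheme.{u}) [IsIntegral Z] [IsNoetherian Z], Scheme.IsRegular Z →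
      Scheme.IsExcellent Z → ∀ (X : Set Z), IsClosed X → X ≠ Set.univ → topologicalKrullDim X ≤ 2 →
        ∃ (Z' : Scheme.{u}) (π : Z' ⟶ Z), IsProper π ∧ Function.Surjective π.base ∧
          (∃ U : Z.Opens, (U : Set Z) = Xᶜ ∧ IsIso (π ∣_ U)) ∧
          IsStrictNormalCrossingsDivisor Z' (π.base ⁻¹' X))
    {R K E : Type u} [CommRing R] [IsRegularLocalRing R] [Field K] [Field E] [Algebra R K]
    [Algebra K E] [Algebra R E] [IsScalarTower R K E]
    (hRK : Function.Injective (algebraMap R K)) (hexc : IsExcellentRing R)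
    {n : ℕ} (hn : n ≤ 2) (hdimR : ringKrullDim R = (n + 1 : ℕ)) (OE : ValuationSubring E)
    (hRO : ∀ r : R, algebraMap R E r ∈ OE)
    (hRm : ∀ r : R, r ∈ maximalIdeal R ↔ OE.valuation (algebraMap R E r) < 1)
    (xR : R) (hxR0 : xR ≠ 0) (hxRm : xR ∈ maximalIdeal R) :
    ∃ uu : Finset E, ((uu : Set E) ⊆ Set.range (algebraMap K E)) ∧
      (∀ y ∈ Algebra.adjoin R (uu : Set E), y ∈ OE) ∧
      ∃ (R' : Type u) (_ : CommRing R') (_ : IsRegularLocalRing R') (_ : Algebra R' E),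
        Function.Injective (algebraMap R' E) ∧ (∀ r : R', algebraMap R' E r ∈ OE) ∧
        (∀ r : R', r ∈ maximalIdeal R' ↔ OE.valuation (algebraMap R' E r) < 1) ∧
        (∀ y ∈ Algebra.adjoin R (uu : Set E), y ∈ Set.range (algebraMap R' E)) ∧
        (∀ r : R', ∃ τ σ : E, τ ∈ Algebra.adjoin R (uu : Set E) ∧ σ ∈ Algebra.adjoin R (uu : Set E) ∧
          OE.valuation σ = 1 ∧ algebraMap R' E r * σ = τ) ∧
        ∃ (d : ℕ) (z : Fin d → R') (α : Fin d → ℕ) (u : R'), IsUnit u ∧ ringKrullDim R' = d ∧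
          Ideal.span (Set.range z) = maximalIdeal R' ∧
          algebraMap R E xR = algebraMap R' E (u * ∏ i, z i ^ α i) := by
  classical
  haveI : IsDomain R := isDomain_of_isRegularLocalRing R
  -- the valuation ring `O = O_E ∩ K` of `K`
  let O : ValuationSubring K := OE.comap (algebraMap K E)
  have hROK : ∀ r : R, algebraMap R K r ∈ O := fun r => by
    change algebraMap K E (algebraMap R K r) ∈ OE
    rw [← IsScalarTower.algebraMap_apply]
    exact hRO r
  have hxRK : O.valuation (algebraMap R K xR) < 1 := by
    rw [valuation_comap_lt_one_iff OE (algebraMap K E), ← IsScalarTower.algebraMap_apply]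
    exact (hRm xR).mp hxRm
  -- embedded resolution of `V(x) ⊂ Spec R`
  haveI : IsDomain (CommRingCat.of R) := ‹IsDomain R›
  haveI : IsNoetherianRing (CommRingCat.of R) := (inferInstance : IsNoetherianRing R)
  haveI : IsRegularRing (CommRingCat.of R) := isRegularRing_of_isRegularLocalRing R
  have hregS : Scheme.IsRegular (Spec (.of R)) := Scheme.isRegular_Spec (.of R)
  have hexcS : Scheme.IsExcellent (Spec (.of R)) := Scheme.isExcellent_Spec_of_isExcellentRing R hexc
  let Xs₀ : Set (PrimeSpectrum R) := PrimeSpectrum.zeroLocus ({xR} : Set R)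
  let Xs : Set (Spec (.of R)) := Xs₀
  have hXs : ∀ p : PrimeSpectrum R, (p : Spec (.of R)) ∈ Xs ↔ xR ∈ p.asIdeal := fun p => by
    change p ∈ PrimeSpectrum.zeroLocus ({xR} : Set R) ↔ _
    rw [PrimeSpectrum.mem_zeroLocus, Set.singleton_subset_iff]
    rfl
  have hXs_eq : Xs = {p : Spec (.of R) | xR ∈ (p : PrimeSpectrum R).asIdeal} :=
    Set.ext fun p => hXs p
  have hXclosed : IsClosed Xs := PrimeSpectrum.isClosed_zeroLocus _
  have hXuniv : Xs ≠ Set.univ := by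
    intro h
    have h1 : ((⊥ : PrimeSpectrum R) : Spec (.of R)) ∈ Xs := by rw [h]; trivial
    rw [hXs] at h1
    exact hxR0 (by simpa using h1)
  have hXdim : topologicalKrullDim Xs ≤ 2 :=
    (topologicalKrullDim_zeroLocus_singleton_le hxR0 hxRm (n := n) hdimR).trans (by exact_mod_cast hn)
  obtain ⟨Z', π, hπproper, -, ⟨U, hU, hUiso⟩, hsnc⟩ :=
    hEmb (Spec (.of R)) hregS hexcS Xs hXclosed hXuniv hXdim
  haveI := hπproper
  haveI := hUiso
  have hU' : ∀ p : PrimeSpectrum R, (p : Spec (.of R)) ∈ U ↔ xR ∉ p.asIdeal := fun p => by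
    have h1 := Set.ext_iff.mp hU p
    exact h1.trans (not_congr (hXs p))
  rw [hXs_eq] at hsnc
  -- the scheme step
  obtain ⟨T₂, hT₂O, hT₂fg, P₂, hP₂prime, hP₂, hT₂reg, d, z, α, u, hu, hdim₂, hspan₂, hfact₂⟩ :=
    exists_fg_regular_monomial_of_isStrictNormalCrossingsDivisor_preimage (A := R) (K := K)
      hRK O hROK xR hxR0 hxRK U hU' hsnc
  obtain ⟨fs, hfs⟩ := hT₂fg
  -- read in `E`
  let valₐ : K →ₐ[R] E := IsScalarTower.toAlgHom R K E
  have hval' : ∀ w : K, valₐ w = algebraMap K E w := fun _ => rfl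
  let uu : Finset E := fs.image (fun w : K => algebraMap K E w)
  have hT₂map : (T₂.map valₐ : Subalgebra R E) = Algebra.adjoin R (uu : Set E) := by
    rw [← hfs, AlgHom.map_adjoin, Finset.coe_image]
    rfl
  have hT₂E : ∀ y : E, y ∈ Algebra.adjoin R (uu : Set E) ↔ ∃ τ : T₂, algebraMap K E (τ : K) = y := by
    intro y
    rw [← hT₂map, Subalgebra.mem_map]
    constructor
    · rintro ⟨w, hw, rfl⟩; exact ⟨⟨w, hw⟩, rfl⟩
    · rintro ⟨τ, rfl⟩; exact ⟨τ, τ.2, rfl⟩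
  have hRuO : ∀ y : E, y ∈ Algebra.adjoin R (uu : Set E) → y ∈ OE := by
    intro y hy
    obtain ⟨τ, rfl⟩ := (hT₂E y).mp hy
    exact hT₂O τ.2
  -- the local ring `R' = (T₂)_{P₂}`, realised in `E`
  let R' : Type u := Localization.AtPrime P₂
  haveI : IsRegularLocalRing R' := hT₂reg
  haveI : IsDomain R' := isDomain_of_isRegularLocalRing R'
  let ι : T₂ →+* E := (algebraMap K E).comp (T₂.val : T₂ →+* K)
  have hι : ∀ τ : T₂, ι τ = algebraMap K E (τ : K) := fun _ => rfl
  have hvalT : ∀ τ : T₂, OE.valuation (ι τ) ≤ 1 := fun τ =>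
    (OE.valuation_le_one_iff _).mpr (hT₂O τ.2)
  have hvP : ∀ τ : T₂, τ ∉ P₂ → OE.valuation (ι τ) = 1 := fun τ hτ => by
    have hnlt : ¬ OE.valuation (ι τ) < 1 := fun hlt => hτ ((hP₂ τ).mpr
      ((valuation_comap_lt_one_iff OE (algebraMap K E) (τ : K)).mpr hlt))
    exact le_antisymm (hvalT τ) (not_lt.mp hnlt)
  have hunits : ∀ y : P₂.primeCompl, IsUnit (ι y) := fun y => by
    rw [isUnit_iff_ne_zero]
    intro h0
    have h1 := hvP y y.2
    rw [h0, map_zero] at h1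
    exact zero_ne_one h1
  letI : Algebra T₂ E := ι.toAlgebra
  let φ : R' →+* E := IsLocalization.lift (M := P₂.primeCompl) hunits
  letI algR'E : Algebra R' E := φ.toAlgebra
  have hφ : ∀ a : T₂, algebraMap R' E (algebraMap T₂ R' a) = ι a := fun a =>
    IsLocalization.lift_eq hunits a
  have hval : ∀ (a : T₂) (b : P₂.primeCompl),
      algebraMap R' E (IsLocalization.mk' R' a b) = ι a * (ι b)⁻¹ ∧ OE.valuation (ι b) = 1 := by
    intro a b
    have hb : OE.valuation (ι b) = 1 := hvP b b.2
    have hb0 : ι b ≠ 0 := fun h0 => by rw [h0, map_zero] at hb; exact zero_ne_one hb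
    refine ⟨?_, hb⟩
    have h1 := IsLocalization.mk'_spec R' a b
    have h2 := congrArg (algebraMap R' E) h1
    rw [map_mul, hφ, hφ] at h2
    rw [← h2, mul_inv_cancel_right₀ hb0]
  have hR'O : ∀ r : R', algebraMap R' E r ∈ OE := by
    intro r
    obtain ⟨⟨a, b⟩, rfl⟩ := IsLocalization.mk'_surjective P₂.primeCompl r
    obtain ⟨hab, hb⟩ := hval a b
    rw [hab]
    refine mul_mem (hT₂O a.2) ?_
    rw [← OE.valuation_le_one_iff, map_inv₀, hb, inv_one]
  have hinjR' : Function.Injective (algebraMap R' E) := by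
    change Function.Injective (IsLocalization.lift (M := P₂.primeCompl) hunits)
    refine (IsLocalization.lift_injective_iff _).mpr fun a b => ⟨fun h => ?_, fun h => ?_⟩
    · rw [IsLocalization.injective R' P₂.primeCompl_le_nonZeroDivisors h]
    · have h' : (a : K) = (b : K) := (algebraMap K E).injective h
      rw [Subtype.ext h']
  have hR'm : ∀ r : R', r ∈ maximalIdeal R' ↔ OE.valuation (algebraMap R' E r) < 1 := by
    intro r
    obtain ⟨⟨a, b⟩, rfl⟩ := IsLocalization.mk'_surjective P₂.primeCompl r
    obtain ⟨hab, hb⟩ := hval a b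
    rw [IsLocalization.AtPrime.mk'_mem_maximal_iff R' P₂ a b, hab, map_mul, map_inv₀, hb, inv_one,
      mul_one, hP₂ a]
    exact valuation_comap_lt_one_iff OE (algebraMap K E) (a : K)
  have hlow : ∀ y ∈ Algebra.adjoin R (uu : Set E), y ∈ Set.range (algebraMap R' E) := by
    intro y hy
    obtain ⟨τ, rfl⟩ := (hT₂E y).mp hy
    exact ⟨algebraMap T₂ R' τ, hφ τ⟩
  have hup : ∀ r : R', ∃ τ σ : E, τ ∈ Algebra.adjoin R (uu : Set E) ∧
      σ ∈ Algebra.adjoin R (uu : Set E) ∧ OE.valuation σ = 1 ∧ algebraMap R' E r * σ = τ := by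
    intro r
    obtain ⟨⟨a, b⟩, rfl⟩ := IsLocalization.mk'_surjective P₂.primeCompl r
    obtain ⟨hab, hb⟩ := hval a b
    have hb0 : ι b ≠ 0 := fun h0 => by rw [h0, map_zero] at hb; exact zero_ne_one hb
    refine ⟨ι a, ι b, (hT₂E _).mpr ⟨a, rfl⟩, (hT₂E _).mpr ⟨(b : T₂), rfl⟩, hb, ?_⟩
    rw [hab, inv_mul_cancel_right₀ hb0]
  refine ⟨uu, ?_, fun y hy => hRuO y hy, R', inferInstance, inferInstance, inferInstance, hinjR',
    hR'O, hR'm, hlow, hup, d, fun i => algebraMap T₂ R' (z i), α, u, hu, hdim₂, ?_, ?_⟩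
  · intro y hy
    obtain ⟨w, -, rfl⟩ := Finset.mem_image.mp (Finset.mem_coe.mp hy)
    exact ⟨w, rfl⟩
  · rw [← hspan₂]
  · rw [← hfact₂, IsScalarTower.algebraMap_apply R T₂ R', hφ, hι, Subalgebra.coe_algebraMap,
      ← IsScalarTower.algebraMap_apply]

end PartV

end Summit.ResolutionOfSingularities.ResolutionOfSingularities.Theorems.PerronLadder
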